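import Summits.Ventures.CertifiedManyBodySolver.Downfold.EmeryShapeWindowClosureBand
import Summits.Ventures.CertifiedManyBodySolver.Downfold.EmeryFermiScalePointsTl2201K26VirtualCorners
import HarnessLib

/-!
# THE ONE-BAND FERMI-SURFACE SHAPE `t′/t` OF THE WHOLE TYPED 3BE BOX `emeryBoxTl2201K26Src (EmeryBoxesKSlicesB)` OVER ITS WHOLE FILLING BAND (two-ray rule + band window closure, §B.86 (k);
# router/EMERY-SHAPE-CORNERS.tsv «band» row)

Venture CertifiedManyBodySolver, cell `pub/hubbard-downfold` (stage S1; INFLATION-RULES-3to1-B §B.86 (k)), seat hubbard-downfold-mod-4 (technique B, g35); namespace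
`Summit.Ventures.CertifiedManyBodySolver.Downfold.Emery`. Everything PROVED (0 sorry). WHAT THIS IS NOT: a statement about Tl₂Ba₂CuO₆ ((K) #12 source POINT) — the typed box is SCREENING-GRADE;
`U = 0` one-body kinematics of the σ model (rigid band); object E = the EXACT `t–t′` shape of the σ Fermi surface.

**For EVERY one-body row of the box AND EVERY filling of the band n_H ∈ [1.25, 1.3] (ν ∈ [7/20, 3/8]): n_H = 1.25 (ν = 3/8) … n_H = 1.30 (ν = 7/20), the one-band t′/t of the σ Fermi surface at that row's own Fermi energy lies in
[-0.2864, -0.286]** (`tl2201K26Box_fsRatio_band`) — `fsRatio_fermiEnergyOf_mem_Icc_windowClosure_band` with the end-filling point brackets: lower window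
[ε_F(V_lo; ν₁)⁻, ε_F(A_lo; ν₂)⁺] = [1.5772, 1.6213] (closure monotone), upper window [0, ε_F(V_hi; ν₂)⁺] = [0, 1.6213] (monotone), regime at ε_F(H; ν₂)⁺ = 1.6213. The per-filling windows of
`EmeryBoxesTl2201K26ShapeCorners` are nested inside (same certificates).

Sources: three-band model [HybertsenSchluterChristensen1989, Eq. (1)]; [AndersenEtAl1995, §6]; box rows as cited in the typed object's file.
-/

noncomputable section

namespace Summit.Ventures.CertifiedManyBodySolver.Downfold.Emery

open Real Set

/-- **Tl₂Ba₂CuO₆ ((K) #12 source POINT), filling band n_H ∈ [1.25, 1.3] (ν ∈ [7/20, 3/8]): n_H = 1.25 (ν = 3/8) … n_H = 1.30 (ν = 7/20): for every row of the box and every filling of the band, the one-band Fermi-surface `t′/t` (object E) lies in `[-0.2864, -0.286]`.** [folklore] -/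
theorem tl2201K26Box_fsRatio_band {Δ a b c ν : ℝ} (hΔ : Δ ∈ Icc ((179 : ℝ) / 100) ((179 : ℝ) / 100)) (ha : a ∈ Icc ((127 : ℝ) / 100) ((127 : ℝ) / 100)) (hb : b ∈ Icc ((63 : ℝ) / 100) ((63 : ℝ) / 100)) (hc : c ∈ Icc ((3 : ℝ) / 20) ((3 : ℝ) / 20)) (hν : ν ∈ Icc ((7 : ℝ) / 20) ((3 : ℝ) / 8)) :
    fsRatio Δ a b c (fermiEnergyOf Δ a b c ν) ∈ Icc ((-179 : ℝ) / 625) ((-143 : ℝ) / 500) := by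
  have hV : ((3 : ℝ) / 20) * ((63 : ℝ) / 100) / ((63 : ℝ) / 100) = ((3 : ℝ) / 20) := by norm_num
  have hW : ((3 : ℝ) / 20) * ((63 : ℝ) / 100) / ((63 : ℝ) / 100) = ((3 : ℝ) / 20) := by norm_num
  have hVlo := (fermiEnergyOf_of_pointBracketCheck virtPt_Tl2201K26H_nH130_br (by norm_num) (by norm_num) (by norm_num) (ν := (7/20 : ℝ)) (by push_cast; exact ⟨le_rfl, le_rfl⟩)).2
  have hVhi := (fermiEnergyOf_of_pointBracketCheck virtPt_Tl2201K26H_nH125_br (by norm_num) (by norm_num) (by norm_num) (ν := (3/8 : ℝ)) (by push_cast; exact ⟨le_rfl, le_rfl⟩)).2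
  have hAlo := (fermiEnergyOf_of_pointBracketCheck virtPt_Tl2201K26H_nH125_br (by norm_num) (by norm_num) (by norm_num) (ν := (3/8 : ℝ)) (by push_cast; exact ⟨le_rfl, le_rfl⟩)).2
  have hTop := (fermiEnergyOf_of_pointBracketCheck virtPt_Tl2201K26H_nH125_br (by norm_num) (by norm_num) (by norm_num) (ν := (3/8 : ℝ)) (by push_cast; exact ⟨le_rfl, le_rfl⟩)).2
  have hLo2 := (fermiEnergyOf_of_pointBracketCheck virtPt_Tl2201K26H_nH130_br (by norm_num) (by norm_num) (by norm_num) (ν := (7/20 : ℝ)) (by push_cast; exact ⟨le_rfl, le_rfl⟩)).2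
  push_cast at hVlo hVhi hAlo hTop
  norm_num at hVlo hVhi hAlo hTop
  refine fsRatio_fermiEnergyOf_mem_Icc_windowClosure_band (Δ₁ := ((179 : ℝ) / 100)) (Δ₂ := ((179 : ℝ) / 100)) (a₁ := ((127 : ℝ) / 100)) (a₂ := ((127 : ℝ) / 100)) (b₁ := ((63 : ℝ) / 100))
    (b₂ := ((63 : ℝ) / 100)) (c₁ := ((3 : ℝ) / 20)) (c₂ := ((3 : ℝ) / 20)) (e₁ := ((3943 : ℝ) / 2500)) (e₂ := ((16213 : ℝ) / 10000)) (e₃ := 0) (e₄ := ((16213 : ℝ) / 10000)) (ν₁ := ((7 : ℝ) / 20)) (ν₂ := ((3 : ℝ) / 8)) (by norm_num) (by norm_num) (by norm_num) (by norm_num)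
    (by norm_num) hΔ ha hb hc (by norm_num) hν (by norm_num) ?_ ?_ ?_ (by norm_num) ?_ ?_ ?_ (by norm_num) ?_
  · nlinarith [hTop.2]
  · rw [hV]; exact hVlo.1
  · exact hAlo.2
  · intro ε hε
    rw [hV]
    have hmono := (fsRatio_mem_Icc_on_window_of_dopingDisc_nonpos (Δ := ((179 : ℝ) / 100)) (a := ((127 : ℝ) / 100)) (b := ((63 : ℝ) / 100)) (c := ((3 : ℝ) / 20))
      (p := ((3943 : ℝ) / 2500)) (q := ((16213 : ℝ) / 10000)) (by norm_num) (by norm_num) (by norm_num) (by norm_num) (by norm_num) (by norm_num) (by norm_num)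
      (by norm_num [dopingDisc]) hε).1
    refine le_trans ?_ hmono
    norm_num [fsRatio, fsD, fsN]
  · exact (fermiEnergyOf_pos (by norm_num) (by norm_num) (by norm_num) (by norm_num) (by norm_num) (by norm_num)).le
  · rw [hW]; exact hVhi.2
  · intro ε hε
    rw [hW]
    have hmono := (fsRatio_mem_Icc_on_window_of_dopingDisc_nonpos (Δ := ((179 : ℝ) / 100)) (a := ((127 : ℝ) / 100)) (b := ((63 : ℝ) / 100)) (c := ((3 : ℝ) / 20))
      (p := 0) (q := ((16213 : ℝ) / 10000)) (by norm_num) (by norm_num) (by norm_num) (by norm_num) (by norm_num) (by norm_num) (by norm_num)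
      (by norm_num [dopingDisc]) hε).2
    refine le_trans hmono ?_
    norm_num [fsRatio, fsD, fsN]

end Summit.Ventures.CertifiedManyBodySolver.Downfold.Emery
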